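import Literature.NumberTheory.GaloisRepresentations.FrobeniusQuotientHOne
import HarnessLib

/-!
# Route `SignedLowerHalves`, crux L `SmallImageLowerHalfBothSigns` (stmt-BirchSwinnertonDyer-23599), line `rtt_w3` v30 — stub S3β″ (`stub_junctionPT_ns`), input N5-(iii) (unramified generator),
# component C3: EVALUATION AT FROBENIUS ON `H¹(Gal(F^nr/F), B)` — every `b ∈ B` is the value of a cocycle at `φ`, and two classes agree iff their values at `φ` agree modulo `(φ − 1)B`

WIDTH seat `bsd-line-slh-p3-w3` g26 under LEAD `cruxlead-stmt-BirchSwinnertonDyer-23599` g14 (cell `bsd-ssimc`); helper `--supports stmt-BirchSwinnertonDyer-23599`. THEOREMS ONLY.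
HONEST FRAMING: the two halves of «`H¹(Γ_F/N, B) ≅ B/(φ − 1)B`, `[z] ↦ z(φ)`» for a finite discrete module `B` over `Q = Γ_F / Gal(F̄/F^nr)`, EXPORTED from the proof of the tree's
`natCard_continuousCohomology_one_quotient_galUnr` (Literature/…/FrobeniusQuotientHOne: `geomCocycle`, `contOneCocycles.eq_zero_of_apply_eq_zero`, `exists_open_normal_invariant`,
`exists_pow_eq_mk_quotient`), for ANY `φ` with `IsFrobPow φ 1` — the evaluation map the unramified generator `u_w` of plan `Lines/rtt_w3-DESIGN-N5iii-w3-g26.md` §2 C3 is defined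
and controlled by. Nothing about S3β″, crux L or BSD is proved; all remain OPEN and are proved for NO curve.

* ★★ `oneCocycleClass_eq_iff_exists_apply_frob` — `[z] = [z′] ↔ ∃ b, z(φ) − z′(φ) = φ b − b`.
* ★★ `exists_contOneCocycles_apply_frob_eq` — `∀ b₀, ∃ z, z(φ) = b₀`.
References: [SerreLocalFields1979] XIII §1 Prop. 1; [MilneADT2006] I §2 Lemma 2.9 (proof); [NeukirchSchmidtWingberg2008] (1.7.1), (7.1.2).
-/

set_option autoImplicit false
set_option linter.dupNamespace false -- D-0017: single-problem summit, the namespace repeats the problem name by design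
noncomputable section

open scoped Pointwise
open CategoryTheory Function
open Field IsNonarchimedeanLocalField ValuativeRel IntermediateField

universe u

namespace Summit.BirchSwinnertonDyer.BirchSwinnertonDyer.Theorems.SmallImageRttD2Seq

open Literature.NumberTheory.GaloisRepresentations
open _root_.TopRep _root_.ContRepresentation _root_.ContinuousCohomology Literature.NumberTheory.GaloisRepresentations.DiscreteGaloisModule
open _root_.Topology _root_.Filter
open Literature.NumberTheory.GaloisRepresentations.LocalWeilDatum

variable (F : Type u) [Field F] [ValuativeRel F] [TopologicalSpace F] [IsNonarchimedeanLocalField F]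
variable {B : Type u} [AddCommGroup B] [TopologicalSpace B] [DiscreteTopology B] [Finite B]

/-- ★★ **Two classes of `H¹(Γ_F/N, B)` agree iff their values at the Frobenius agree modulo `(φ − 1)B`** (injectivity of `[z] ↦ z(φ) mod (φ − 1)B`: a cocycle right-invariant under an
open normal subgroup of the procyclic `Γ_F/N = ⟨φ⟩` and vanishing at `φ` vanishes). [cite: SerreLocalFields1979, XIII §1 Prop. 1] [cite: MilneADT2006, I §2 Lemma 2.9 (proof)] -/
theorem oneCocycleClass_eq_iff_exists_apply_frob (τ : ContinuousRep (absoluteGaloisGroup F ⧸ galUnr F) ℤ B) {φ : absoluteGaloisGroup F} (hφ : IsFrobPow φ 1)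
    (z z' : contOneCocycles τ.toTopRep) :
    oneCocycleClass _ z = oneCocycleClass _ z' ↔
      ∃ b : B, z.1 (QuotientGroup.mk φ) - z'.1 (QuotientGroup.mk φ) = τ (QuotientGroup.mk φ) b - b := by
  haveI := absoluteGaloisGroup_compactSpace F
  set Q := absoluteGaloisGroup F ⧸ galUnr F
  set φQ : Q := QuotientGroup.mk φ with hφQ
  have hgen : ∀ (H : Subgroup Q) [H.Normal], IsOpen (H : Set Q) → ∀ r : Q ⧸ H, ∃ i : ℕ, r = (QuotientGroup.mk φQ : Q ⧸ H) ^ i :=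
    fun H _ hH r ↦ exists_pow_eq_mk_quotient F H hH hφ r
  constructor
  · intro h
    have h0 : oneCocycleClass _ (z - z') = 0 := by rw [oneCocycleClass_sub, h, sub_self]
    obtain ⟨v, hv⟩ := (oneCocycleClass_eq_zero_iff _ _).1 h0
    exact ⟨v, hv φQ⟩
  · rintro ⟨b, hb⟩
    set w : contOneCocycles τ.toTopRep := z - z' - coboundaryCocycle τ b with hwdef
    obtain ⟨H, hHn, hHo, -, hHw⟩ := exists_open_normal_invariant F τ w
    haveI := hHn
    have hw0 : w = 0 := by
      refine contOneCocycles.eq_zero_of_apply_eq_zero φQ H (hgen H hHo) w hHw ?_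
      change z.1 φQ - z'.1 φQ - (τ φQ b - b) = 0
      rw [hb, sub_self]
    have h1 : oneCocycleClass _ z - oneCocycleClass _ z' = 0 := by
      rw [← oneCocycleClass_sub, show z - z' = w + coboundaryCocycle τ b by rw [hwdef]; abel, hw0, zero_add, oneCocycleClass_coboundaryCocycle]
    exact sub_eq_zero.mp h1

/-- ★★ **Every `b₀ ∈ B` is the value at the Frobenius of a continuous cocycle of `Γ_F/N`** (surjectivity of `[z] ↦ z(φ) mod (φ − 1)B`): the geometric-sum cocycle of `b₀` at an open
normal level of index a multiple of `#B · n₀`, where the norm of `b₀` vanishes. [cite: SerreLocalFields1979, XIII §1 Prop. 1] [cite: MilneADT2006, I §2 Lemma 2.9 (proof)]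
[cite: NeukirchSchmidtWingberg2008, (1.7.1)] -/
theorem exists_contOneCocycles_apply_frob_eq (τ : ContinuousRep (absoluteGaloisGroup F ⧸ galUnr F) ℤ B) {φ : absoluteGaloisGroup F} (hφ : IsFrobPow φ 1) (b₀ : B) :
    ∃ z : contOneCocycles τ.toTopRep, z.1 (QuotientGroup.mk φ) = b₀ := by
  classical
  haveI := absoluteGaloisGroup_compactSpace F
  set Q := absoluteGaloisGroup F ⧸ galUnr F
  set φQ : Q := QuotientGroup.mk φ with hφQ
  have hgen : ∀ (H : Subgroup Q) [H.Normal], IsOpen (H : Set Q) → ∀ r : Q ⧸ H, ∃ i : ℕ, r = (QuotientGroup.mk φQ : Q ⧸ H) ^ i :=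
    fun H _ hH r ↦ exists_pow_eq_mk_quotient F H hH hφ r
  -- an open normal subgroup acting trivially
  obtain ⟨H₀, hH₀n, hH₀o, hH₀X, -⟩ := exists_open_normal_invariant F τ 0
  haveI := hH₀n
  haveI : Finite (Q ⧸ H₀) := Subgroup.quotient_finite_of_isOpen H₀ hH₀o
  -- the deeper level `H₁` at which the norm of `b₀` vanishes
  set n₀ : ℕ := orderOf (QuotientGroup.mk φQ : Q ⧸ H₀) with hn₀
  have hn₀pos : 0 < n₀ := orderOf_pos _
  set m : ℕ := Nat.card B * n₀ with hmdef
  have hm : 0 < m := Nat.mul_pos Nat.card_pos hn₀pos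
  haveI := (unramifiedLevel_finite_abelian_unramified F hm).1
  haveI := (unramifiedLevel_finite_abelian_unramified F hm).2.1
  haveI : (galFixing F (unramifiedLevel F m)).Normal := normal_galFixing _
  let H₁ : Subgroup Q := H₀ ⊓ (galFixing F (unramifiedLevel F m)).map (QuotientGroup.mk' (galUnr F))
  haveI : ((galFixing F (unramifiedLevel F m)).map (QuotientGroup.mk' (galUnr F))).Normal :=
    Subgroup.Normal.map inferInstance _ (QuotientGroup.mk'_surjective _)
  haveI : H₁.Normal := inferInstance
  have hH₁o : IsOpen (H₁ : Set Q) := by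
    change IsOpen ((H₀ : Set Q) ∩ ((QuotientGroup.mk' (galUnr F)) '' (galFixing F (unramifiedLevel F m) : Set _)))
    exact hH₀o.inter (QuotientGroup.isOpenMap_coe _ (isOpen_galFixing F _))
  have hH₁₀ : H₁ ≤ H₀ := inf_le_left
  haveI : Finite (Q ⧸ H₁) := Subgroup.quotient_finite_of_isOpen H₁ hH₁o
  set n₁ : ℕ := orderOf (QuotientGroup.mk φQ : Q ⧸ H₁) with hn₁
  have hpow₁ : φQ ^ n₁ ∈ H₁ := by
    rw [← QuotientGroup.eq_one_iff, QuotientGroup.mk_pow, hn₁]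
    exact pow_orderOf_eq_one _
  have hφm : φ ^ n₁ ∈ galFixing F (unramifiedLevel F m) := by
    have h2 : (QuotientGroup.mk (φ ^ n₁) : Q) ∈ (galFixing F (unramifiedLevel F m)).map (QuotientGroup.mk' (galUnr F)) := by
      have := hpow₁.2
      rwa [hφQ, ← QuotientGroup.mk_pow] at this
    have h3 : φ ^ n₁ ∈ ((galFixing F (unramifiedLevel F m)).map (QuotientGroup.mk' (galUnr F))).comap (QuotientGroup.mk' (galUnr F)) := h2
    rw [Subgroup.comap_map_eq, QuotientGroup.ker_mk', sup_eq_left.2 (galUnr_le_galFixing_unramifiedLevel F hm)] at h3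
    exact h3
  have hmn₁ : m ∣ n₁ := by
    have hfix : (φ ^ n₁) • rootOfUnramifiedLevel F m = rootOfUnramifiedLevel F m :=
      (mem_galFixing_iff F).1 hφm _ (IntermediateField.mem_adjoin_simple_self F _)
    exact (smul_eq_self_iff_dvd_of_isFrobPow F hm (isPrimitiveRoot_rootOfUnramifiedLevel F hm) (isFrobPow_pow F hφ n₁)).1 hfix
  have hn₀₁ : n₀ ∣ n₁ := by
    rw [hn₀]
    apply orderOf_dvd_of_pow_eq_one
    rw [← QuotientGroup.mk_pow, QuotientGroup.eq_one_iff]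
    exact hH₁₀ hpow₁
  obtain ⟨k, hk⟩ := hn₀₁
  have hNk : Nat.card B ∣ k := by
    have h := hmn₁
    rw [hk, hmdef, mul_comm (Nat.card B) n₀] at h
    exact Nat.dvd_of_mul_dvd_mul_left hn₀pos h
  -- the norm vanishes at level `H₁`
  have hφn₀ : ∀ x : B, τ.toTopRep.ρ (φQ ^ n₀) x = x := fun x ↦ by
    rw [ContinuousRep.toTopRep_ρ_apply]
    refine hH₀X _ ?_ x
    rw [← QuotientGroup.eq_one_iff, QuotientGroup.mk_pow, hn₀]
    exact pow_orderOf_eq_one _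
  have hN : geomSum (X := τ.toTopRep) φQ b₀ (orderOf (QuotientGroup.mk φQ : Q ⧸ H₁)) = 0 := by
    rw [← hn₁, hk, geomSum_mul_eq_smul (X := τ.toTopRep) φQ b₀ hφn₀ k]
    obtain ⟨k', rfl⟩ := hNk
    rw [mul_comm, mul_nsmul, card_nsmul_eq_zero']
  let z : contOneCocycles τ.toTopRep := geomCocycle φQ b₀ H₁ (hgen H₁ hH₁o) hH₁o
    (fun h hh x ↦ by rw [ContinuousRep.toTopRep_ρ_apply]; exact hH₀X h (hH₁₀ hh) x) hN
  exact ⟨z, geomCocycle_apply_self (X := τ.toTopRep) φQ b₀ H₁ (hgen H₁ hH₁o) hH₁o _ hN⟩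

end Summit.BirchSwinnertonDyer.BirchSwinnertonDyer.Theorems.SmallImageRttD2Seq

end
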